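import Literature.AlgebraicGeometry.Frobenioids.ArithmeticDivisorsMonoidIsoPlaces
import Literature.AlgebraicGeometry.Frobenioids.ArithmeticDivisorsDegreeTransport
import HarnessLib

/-!
# Frobenioids I, Thm. 6.4 (iv) at the constructions: an isomorphism of arithmetic divisor monoids is
# MONOMIAL on the archimedean part — a bijection of infinite places with positive scalings

Mochizuki, *The geometry of Frobenioids I: the general theory*, Kyushu J. Math. **62** (2008) 293–400, §6,
Ex. 6.3 pp. 112–114 (`Φ(L) = ⊕_v ord(O_v^▷)`, `ord(O_v^▷) ≅ ℝ_{≥0}` archimedean) and Thm. 6.4 (iii)/(iv) pp. 115–116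
("a bijection between the primes … archimedean elements to archimedean elements") [cite: MochizukiFrdI2008, Thm. 6.4 (iv) p.116].

PROOF-ONLY file (cell abc-iut, GAP-LEDGER row G-L1t3-1 #2, the archimedean twin of
`ArithmeticDivisorsMonoidIsoPlaces`; seat abc-iut-w4-d090, piece (R1) of abc-iut-L1-d3's archimedean-rigidity
programme for the non-Galois clause of Thm. 6.4 (iv)).  The tree's `EffArithDivisor.exists_decomposition`
writes an additive isomorphism `e : Φ(L₁) ⥲ Φ(L₂)` as `e (f, t) = (π_* f, g t)` with `π` a bijection of finite
places and `g : (V(L₁)^arc → ℝ_{≥0}) ⥲ (V(L₂)^arc → ℝ_{≥0})` an additive bijection.  Here: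
* `addEquiv_nnrealPi_monomial` — pure: an additive isomorphism `g : (ι₁ → ℝ_{≥0}) ⥲ (ι₂ → ℝ_{≥0})` (`ι₁`
  finite) is MONOMIAL, `g t (σ i) = c_i · t_i` for a bijection `σ : ι₁ ≃ ι₂` and constants `c_i > 0` (`g` is an
  order isomorphism of cones; "supported at one point" = "the elements below form a chain"; each slice
  `ℝ_{≥0} →+ ℝ_{≥0}` is automatically monotone, hence linear);
* `EffArithDivisor.exists_decomposition_monomial` (+ `Multiplicative` form `…_mulEquiv`) — hence
  `e (f, t) = (π_* f, σ_* (c · t))`: a bijection `σ` of INFINITE places with positive scalings `c_v`;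
* `ArithDivisor.arch_apply_of_restrict` / `fin_apply_of_restrict` — the same formulas for an additive map of
  `Φ^gp = ⊕_v ord(L_v)` restricting to `e` (every arithmetic divisor is a difference of effective ones);
* `ArithDivisor.mult_mul_scaling_eq` — if moreover `deg₂ ∘ e^gp = c₀ · deg₁` (`exists_arithDegree_comp_eq_mul`),
  then `[L₂,σv : ℝ] · c_v = c₀ · [L₁,v : ℝ]` (for `c₀ = 1`: `c_v = 1` iff `σ` preserves the real/complex type).
No definitions, no named facts; nothing here bears on [IUTchIII] Cor. 3.12 or asserts anything about abc.
-/

noncomputable section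

namespace Literature.AlgebraicGeometry.Frobenioids

open NumberField

/-! ### Additive isomorphisms of cones `ι → ℝ_{≥0}` are monomial -/

section Cone

variable {ι ι₁ ι₂ : Type*}

/-- In the cone `ι → ℝ_{≥0}`, `s ≤ t` iff `t = s + d` for some `d` (the order is the algebraic one).
[cite: MochizukiFrdI2008, Ex. 6.3 p.113] -/
theorem nnrealPi_le_iff_exists_add {s t : ι → NNReal} : s ≤ t ↔ ∃ d, t = s + d := by
  constructor
  · intro h
    exact ⟨fun i => t i - s i, funext fun i => by rw [Pi.add_apply, add_tsub_cancel_of_le (h i)]⟩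
  · rintro ⟨d, rfl⟩
    exact fun i => le_self_add

/-- An additive isomorphism of cones `(ι₁ → ℝ_{≥0}) ⥲ (ι₂ → ℝ_{≥0})` is an ORDER isomorphism.
[cite: MochizukiFrdI2008, Thm. 6.4 (iv) p.116] -/
theorem addEquiv_nnrealPi_le_iff (g : (ι₁ → NNReal) ≃+ (ι₂ → NNReal)) {s t : ι₁ → NNReal} :
    g s ≤ g t ↔ s ≤ t := by
  rw [nnrealPi_le_iff_exists_add, nnrealPi_le_iff_exists_add]
  constructor
  · rintro ⟨d, hd⟩
    refine ⟨g.symm d, g.injective ?_⟩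
    rw [map_add, g.apply_symm_apply]
    exact hd
  · rintro ⟨d, rfl⟩
    exact ⟨g d, map_add g s d⟩

/-- An element below a generator `δ_i^r = Pi.single i r` is again supported at `i`.
[cite: MochizukiFrdI2008, Ex. 6.3 p.113] -/
theorem nnrealPi_eq_single_of_le_single [DecidableEq ι] {i : ι} {r : NNReal} {a : ι → NNReal}
    (h : a ≤ Pi.single i r) : a = Pi.single i (a i) := by
  funext j
  by_cases hj : j = i
  · subst hj; rw [Pi.single_eq_same]
  · rw [Pi.single_eq_of_ne hj]
    have := h j
    rw [Pi.single_eq_of_ne hj] at this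
    exact le_zero_iff.mp this

/-- Generators at one index are monotone in the coefficient. [cite: MochizukiFrdI2008, Ex. 6.3 p.113] -/
theorem nnrealPi_single_le_single [DecidableEq ι] (i : ι) {r r' : NNReal} (h : r ≤ r') :
    (Pi.single i r : ι → NNReal) ≤ Pi.single i r' := fun j => by
  by_cases hj : j = i
  · subst hj; rwa [Pi.single_eq_same, Pi.single_eq_same]
  · rw [Pi.single_eq_of_ne hj, Pi.single_eq_of_ne hj]

/-- Comparable nonzero generators sit at the same index. [cite: MochizukiFrdI2008, Ex. 6.3 p.113] -/
theorem nnrealPi_index_eq_of_single_le_single [DecidableEq ι] {j j' : ι} {s s' : NNReal} (hs : s ≠ 0)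
    (h : (Pi.single j s : ι → NNReal) ≤ Pi.single j' s') : j = j' := by
  by_contra hne
  have := h j
  rw [Pi.single_eq_same, Pi.single_eq_of_ne hne] at this
  exact hs (le_zero_iff.mp this)

/-- The elements below a generator `Pi.single i r` form a CHAIN. [cite: MochizukiFrdI2008, Ex. 6.3 p.113] -/
theorem nnrealPi_chain_below_single [DecidableEq ι] (i : ι) (r : NNReal) (a b : ι → NNReal)
    (ha : a ≤ Pi.single i r) (hb : b ≤ Pi.single i r) : a ≤ b ∨ b ≤ a := by
  rw [nnrealPi_eq_single_of_le_single ha, nnrealPi_eq_single_of_le_single hb]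
  rcases le_total (a i) (b i) with h | h
  · exact Or.inl (nnrealPi_single_le_single i h)
  · exact Or.inr (nnrealPi_single_le_single i h)

/-- Conversely, a nonzero element below which the order is a CHAIN is a generator `Pi.single i r`, `r ≠ 0`:
"supported at one point" is an order-theoretic, hence isomorphism-invariant, property.
[cite: MochizukiFrdI2008, Thm. 6.4 (iv) p.116] -/
theorem nnrealPi_exists_eq_single_of_chain [DecidableEq ι] {t : ι → NNReal} (h0 : t ≠ 0)
    (hch : ∀ a b : ι → NNReal, a ≤ t → b ≤ t → a ≤ b ∨ b ≤ a) :
    ∃ i r, r ≠ 0 ∧ t = Pi.single i r := by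
  obtain ⟨i, hi⟩ : ∃ i, t i ≠ 0 := by
    by_contra h
    exact h0 (funext fun i => not_not.mp (not_exists.mp h i))
  have hle : ∀ k, Pi.single k (t k) ≤ t := fun k l => by
    by_cases hl : l = k
    · subst hl; rw [Pi.single_eq_same]
    · rw [Pi.single_eq_of_ne hl]; exact bot_le
  refine ⟨i, t i, hi, funext fun j => ?_⟩
  by_cases hj : j = i
  · subst hj; rw [Pi.single_eq_same]
  · rw [Pi.single_eq_of_ne hj]
    by_contra hne
    rcases hch _ _ (hle i) (hle j) with h | h
    · have := h i
      rw [Pi.single_eq_same, Pi.single_eq_of_ne (Ne.symm hj)] at this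
      exact hi (le_zero_iff.mp this)
    · have := h j
      rw [Pi.single_eq_same, Pi.single_eq_of_ne hj] at this
      exact hne (le_zero_iff.mp this)

/-- **An additive isomorphism of cones carries generators to generators**: `g (Pi.single i r) = Pi.single j s`
with `s ≠ 0` (for `r ≠ 0`). [cite: MochizukiFrdI2008, Thm. 6.4 (iv) p.116] -/
theorem addEquiv_nnrealPi_exists_map_single [DecidableEq ι₁] [DecidableEq ι₂]
    (g : (ι₁ → NNReal) ≃+ (ι₂ → NNReal)) (i : ι₁) (r : NNReal) (hr : r ≠ 0) :
    ∃ j s, s ≠ 0 ∧ g (Pi.single i r) = Pi.single j s := by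
  refine nnrealPi_exists_eq_single_of_chain ?_ fun a b ha hb => ?_
  · intro h
    have := congrFun ((EmbeddingLike.map_eq_zero_iff (f := g)).mp h) i
    rw [Pi.single_eq_same, Pi.zero_apply] at this
    exact hr this
  · have ha' : g.symm a ≤ Pi.single i r := by
      rw [← addEquiv_nnrealPi_le_iff g, g.apply_symm_apply]; exact ha
    have hb' : g.symm b ≤ Pi.single i r := by
      rw [← addEquiv_nnrealPi_le_iff g, g.apply_symm_apply]; exact hb
    rcases nnrealPi_chain_below_single i r _ _ ha' hb' with h | h
    · left
      have := (addEquiv_nnrealPi_le_iff g).mpr h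
      rwa [g.apply_symm_apply, g.apply_symm_apply] at this
    · right
      have := (addEquiv_nnrealPi_le_iff g).mpr h
      rwa [g.apply_symm_apply, g.apply_symm_apply] at this

/-- The index of the image generator depends only on the index of the source generator.
[cite: MochizukiFrdI2008, Thm. 6.4 (iv) p.116] -/
theorem addEquiv_nnrealPi_index_eq [DecidableEq ι₁] [DecidableEq ι₂]
    (g : (ι₁ → NNReal) ≃+ (ι₂ → NNReal)) {i : ι₁} {j j' : ι₂} {r r' s s' : NNReal}
    (hs : s ≠ 0) (hs' : s' ≠ 0) (h : g (Pi.single i r) = Pi.single j s)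
    (h' : g (Pi.single i r') = Pi.single j' s') : j = j' := by
  rcases le_total r r' with hrr | hrr
  · have hle := (addEquiv_nnrealPi_le_iff g).mpr (nnrealPi_single_le_single i hrr)
    rw [h, h'] at hle
    exact nnrealPi_index_eq_of_single_le_single hs hle
  · have hle := (addEquiv_nnrealPi_le_iff g).mpr (nnrealPi_single_le_single i hrr)
    rw [h, h'] at hle
    exact (nnrealPi_index_eq_of_single_le_single hs' hle).symm

/-- **An additive map `ℝ_{≥0} → ℝ_{≥0}` is linear**, `φ r = φ 1 · r`: it is automatically monotone, and
its extension to `ℝ` is an additive monotone map, hence linear (`addMonoidHom_real_apply_eq_mul_of_monotone`).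
[cite: MochizukiFrdI2008, Thm. 6.4 (ii) p.115] -/
theorem addMonoidHom_nnreal_apply_eq_mul (φ : NNReal →+ NNReal) (r : NNReal) : φ r = φ 1 * r := by
  -- differences are well defined
  have hkey : ∀ a b a' b' : NNReal, (a : ℝ) - b = a' - b' → (φ a : ℝ) - φ b = φ a' - φ b' := by
    intro a b a' b' h
    have h2 : a + b' = a' + b := NNReal.coe_injective (by push_cast; linarith)
    have h3 : (φ a : ℝ) + φ b' = φ a' + φ b := by exact_mod_cast (show φ a + φ b' = φ a' + φ b by
      rw [← map_add, h2, map_add])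
    linarith
  have e1 : ∀ a : ℝ, ((a.toNNReal : NNReal) : ℝ) - (((-a).toNNReal : NNReal) : ℝ) = a := fun a => by
    rw [Real.coe_toNNReal', Real.coe_toNNReal']
    exact max_zero_sub_max_neg_zero_eq_self a
  -- the extension `ψ` of `φ` to `ℝ`
  let ψ : ℝ →+ ℝ :=
    { toFun := fun x => (φ x.toNNReal : ℝ) - φ (-x).toNNReal
      map_zero' := by simp
      map_add' := fun x y => by
        have h := hkey (x + y).toNNReal (-(x + y)).toNNReal (x.toNNReal + y.toNNReal)
          ((-x).toNNReal + (-y).toNNReal) (by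
            rw [NNReal.coe_add, NNReal.coe_add, e1]
            linarith [e1 x, e1 y])
        simp only [map_add, NNReal.coe_add] at h
        simp only [h]
        ring }
  have hψ_apply : ∀ x : ℝ, ψ x = (φ x.toNNReal : ℝ) - φ (-x).toNNReal := fun x => rfl
  have hψ_coe : ∀ a : NNReal, ψ a = φ a := fun a => by
    rw [hψ_apply, Real.toNNReal_coe, Real.toNNReal_eq_zero.mpr (neg_nonpos.mpr a.coe_nonneg), map_zero,
      NNReal.coe_zero, sub_zero]
  have hψ_mono : Monotone ψ := fun x y hxy => by
    have h0 : 0 ≤ ψ (y - x) := by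
      rw [hψ_apply, Real.toNNReal_eq_zero.mpr (by linarith : -(y - x) ≤ 0), map_zero, NNReal.coe_zero,
        sub_zero]
      exact (φ _).coe_nonneg
    rw [map_sub] at h0
    linarith
  have h := addMonoidHom_real_apply_eq_mul_of_monotone ψ hψ_mono r
  rw [hψ_coe, ← NNReal.coe_one, hψ_coe] at h
  exact_mod_cast h

/-- **An additive isomorphism of finite-dimensional cones `(ι₁ → ℝ_{≥0}) ⥲ (ι₂ → ℝ_{≥0})` is MONOMIAL**: there
are a bijection `σ : ι₁ ≃ ι₂` and constants `c_i > 0` with `(g t)(σ i) = c_i · t_i` — equivalently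
`g t = σ_* (c · t)`.  (The archimedean part `g` of an isomorphism of arithmetic divisor monoids,
`EffArithDivisor.exists_decomposition`, is of this form.) [cite: MochizukiFrdI2008, Thm. 6.4 (iv) p.116] -/
theorem addEquiv_nnrealPi_monomial [Fintype ι₁] (g : (ι₁ → NNReal) ≃+ (ι₂ → NNReal)) :
    ∃ (σ : ι₁ ≃ ι₂) (c : ι₁ → NNReal), (∀ i, c i ≠ 0) ∧ ∀ (t : ι₁ → NNReal) (i : ι₁), g t (σ i) = c i * t i := by
  classical
  choose σ c hc hσ using fun i => addEquiv_nnrealPi_exists_map_single g i (1 : NNReal) one_ne_zero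
  choose σ' c' hc' hσ' using fun j => addEquiv_nnrealPi_exists_map_single g.symm j (1 : NNReal) one_ne_zero
  have h1 : ∀ j, σ (σ' j) = j := fun j => by
    have ha : g (Pi.single (σ' j) (c' j)) = Pi.single j 1 := by rw [← hσ' j, g.apply_symm_apply]
    exact addEquiv_nnrealPi_index_eq g (hc (σ' j)) one_ne_zero (hσ (σ' j)) ha
  have h2 : ∀ i, σ' (σ i) = i := fun i => by
    have ha : g.symm (Pi.single (σ i) (c i)) = Pi.single i 1 := by rw [← hσ i, g.symm_apply_apply]
    exact addEquiv_nnrealPi_index_eq g.symm (hc' (σ i)) one_ne_zero (hσ' (σ i)) ha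
  let σE : ι₁ ≃ ι₂ := ⟨σ, σ', h2, h1⟩
  -- each slice `r ↦ g (δ_i^r)` is supported at `σ i` and linear in `r`
  have hslice : ∀ (i : ι₁) (r : NNReal), g (Pi.single i r) = Pi.single (σ i) (c i * r) := by
    intro i r
    by_cases hr : r = 0
    · subst hr; rw [Pi.single_zero, map_zero, mul_zero, Pi.single_zero]
    obtain ⟨j, s, hs, hj⟩ := addEquiv_nnrealPi_exists_map_single g i r hr
    have hji : j = σ i := addEquiv_nnrealPi_index_eq g hs (hc i) hj (hσ i)
    rw [hji] at hj
    let φ : NNReal →+ NNReal :=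
      (Pi.evalAddMonoidHom (fun _ : ι₂ => NNReal) (σ i)).comp
        (g.toAddMonoidHom.comp (AddMonoidHom.single (fun _ : ι₁ => NNReal) i))
    have hφ : ∀ r, φ r = g (Pi.single i r) (σ i) := fun r => rfl
    have hφ1 : φ 1 = c i := by rw [hφ, hσ i, Pi.single_eq_same]
    have hsr : s = φ r := by rw [hφ, hj, Pi.single_eq_same]
    rw [hj, hsr, addMonoidHom_nnreal_apply_eq_mul φ r, hφ1]
  have hinj : ∀ a b, σ a = σ b → a = b := fun a b h => by rw [← h2 a, ← h2 b, h]
  refine ⟨σE, c, hc, fun t i => ?_⟩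
  show g t (σ i) = c i * t i
  conv_lhs => rw [← Finset.univ_sum_single t]
  rw [map_sum, Finset.sum_apply, Finset.sum_eq_single i]
  · rw [hslice, Pi.single_eq_same]
  · intro k _ hk
    rw [hslice, Pi.single_eq_of_ne]
    exact fun h => hk (hinj _ _ h).symm
  · exact fun hi => absurd (Finset.mem_univ i) hi

end Cone

/-! ### At `Φ(L)`: a bijection of infinite places with positive scalings -/

namespace EffArithDivisor

variable {L₁ : Type*} [Field L₁] [NumberField L₁] {L₂ : Type*} [Field L₂] [NumberField L₂]

/-- **Structure of an isomorphism of effective arithmetic divisor monoids, archimedean part included**: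
`e (f, t) = (π_* f, σ_* (c · t))` — the bijection `π` of FINITE places (generator to generator), a bijection `σ`
of INFINITE places and positive scalings `c_v` on the factors `ord(O_v^▷) ≅ ℝ_{≥0}` ("archimedean elements to
archimedean elements").  [cite: MochizukiFrdI2008, Thm. 6.4 (iv) p.116] -/
theorem exists_decomposition_monomial (e : EffArithDivisor L₁ ≃+ EffArithDivisor L₂) :
    ∃ (π : FinitePlace L₁ ≃ FinitePlace L₂) (σ : InfinitePlace L₁ ≃ InfinitePlace L₂)
      (c : InfinitePlace L₁ → NNReal), (∀ v, c v ≠ 0) ∧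
        (∀ w, e (Finsupp.single w 1, 0) = (Finsupp.single (π w) 1, 0)) ∧
          (∀ D : EffArithDivisor L₁, (e D).1 = Finsupp.equivMapDomain π D.1) ∧
            ∀ (D : EffArithDivisor L₁) (v : InfinitePlace L₁), (e D).2 (σ v) = c v * D.2 v := by
  obtain ⟨π, g, hπ, hD⟩ := exists_decomposition e
  obtain ⟨σ, c, hc, hg⟩ := addEquiv_nnrealPi_monomial g
  exact ⟨π, σ, c, hc, hπ, fun D => by rw [hD], fun D v => by rw [hD]; exact hg D.2 v⟩

/-- The archimedean generator of coordinate `r` at `v` goes to the archimedean generator of coordinate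
`c_v · r` at `σ v`. [cite: MochizukiFrdI2008, Thm. 6.4 (iv) p.116] -/
theorem map_arch_single [DecidableEq (InfinitePlace L₁)] [DecidableEq (InfinitePlace L₂)]
    (e : EffArithDivisor L₁ ≃+ EffArithDivisor L₂) {π : FinitePlace L₁ ≃ FinitePlace L₂}
    {σ : InfinitePlace L₁ ≃ InfinitePlace L₂} {c : InfinitePlace L₁ → NNReal}
    (h1 : ∀ D : EffArithDivisor L₁, (e D).1 = Finsupp.equivMapDomain π D.1)
    (h2 : ∀ (D : EffArithDivisor L₁) (v : InfinitePlace L₁), (e D).2 (σ v) = c v * D.2 v)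
    (v : InfinitePlace L₁) (r : NNReal) :
    e (0, Pi.single v r) = (0, Pi.single (σ v) (c v * r)) := by
  refine Prod.ext ?_ (funext fun v' => ?_)
  · rw [h1]; exact Finsupp.equivMapDomain_zero
  · obtain ⟨u, rfl⟩ := σ.surjective v'
    rw [h2]
    show c u * (Pi.single v r : InfinitePlace L₁ → NNReal) u =
      (Pi.single (σ v) (c v * r) : InfinitePlace L₂ → NNReal) (σ u)
    by_cases hu : u = v
    · subst hu; rw [Pi.single_eq_same, Pi.single_eq_same]
    · rw [Pi.single_eq_of_ne hu, Pi.single_eq_of_ne (fun h => hu (σ.injective h)), mul_zero]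

end EffArithDivisor

/-! ### The same formulas on `Φ^gp = ⊕_v ord(L_v)` for a map restricting to `e` -/

namespace ArithDivisor

variable {L₁ : Type} [Field L₁] [NumberField L₁] {L₂ : Type} [Field L₂] [NumberField L₂]

/-- An additive map `eG : Φ(L₁)^gp → Φ(L₂)^gp` restricting to `e` on `Φ` has archimedean components
`(eG d)(σ v) = c_v · d_v` for EVERY arithmetic divisor `d` (differences of effective ones) — in particular for
principal divisors, `-log|y|_{σ v} = c_v · (-log|x|_v)` whenever `eG (div x) = div y`.
[cite: MochizukiFrdI2008, Thm. 6.4 (iv) p.116] -/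
theorem arch_apply_of_restrict (eG : ArithDivisor L₁ →+ ArithDivisor L₂)
    (eE : EffArithDivisor L₁ →+ EffArithDivisor L₂)
    (heG : ∀ D, eG (EffArithDivisor.toArithDivisor L₁ D) = EffArithDivisor.toArithDivisor L₂ (eE D))
    {σ : InfinitePlace L₁ ≃ InfinitePlace L₂} {c : InfinitePlace L₁ → NNReal}
    (h2 : ∀ (D : EffArithDivisor L₁) (v : InfinitePlace L₁), (eE D).2 (σ v) = c v * D.2 v)
    (d : ArithDivisor L₁) (v : InfinitePlace L₁) : (eG d).2 (σ v) = c v * d.2 v := by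
  obtain ⟨D, E, rfl⟩ := ArithDivisor.exists_sub_eq L₁ d
  rw [map_sub, heG, heG, Prod.snd_sub, Prod.snd_sub, Pi.sub_apply, Pi.sub_apply,
    EffArithDivisor.toArithDivisor_snd, EffArithDivisor.toArithDivisor_snd, h2, h2,
    EffArithDivisor.toArithDivisor_snd, EffArithDivisor.toArithDivisor_snd]
  push_cast
  ring

/-- Finite components likewise: `(eG d)(π w) = d_w` for every arithmetic divisor `d` (for principal
divisors: `ord_{π w}(y) = ord_w(x)`). [cite: MochizukiFrdI2008, Thm. 6.4 (iv) p.116] -/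
theorem fin_apply_of_restrict (eG : ArithDivisor L₁ →+ ArithDivisor L₂)
    (eE : EffArithDivisor L₁ →+ EffArithDivisor L₂)
    (heG : ∀ D, eG (EffArithDivisor.toArithDivisor L₁ D) = EffArithDivisor.toArithDivisor L₂ (eE D))
    {π : FinitePlace L₁ ≃ FinitePlace L₂}
    (h1 : ∀ D : EffArithDivisor L₁, (eE D).1 = Finsupp.equivMapDomain π D.1)
    (d : ArithDivisor L₁) (w : FinitePlace L₁) : (eG d).1 (π w) = d.1 w := by
  obtain ⟨D, E, rfl⟩ := ArithDivisor.exists_sub_eq L₁ d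
  rw [map_sub, heG, heG, Prod.fst_sub, Prod.fst_sub, Finsupp.sub_apply, Finsupp.sub_apply,
    EffArithDivisor.toArithDivisor_fst, EffArithDivisor.toArithDivisor_fst, h1, h1,
    Finsupp.equivMapDomain_apply, Finsupp.equivMapDomain_apply, Equiv.symm_apply_apply,
    EffArithDivisor.toArithDivisor_fst, EffArithDivisor.toArithDivisor_fst]

/-- **Scalings versus local degrees**: if `deg₂ ∘ eG = c₀ · deg₁` (the tree's
`exists_arithDegree_comp_eq_mul`: `eG` restricts to `Φ` and carries principal divisors to principal divisors),
then `[L₂,σv : ℝ] · c_v = c₀ · [L₁,v : ℝ]` for every infinite place `v` — evaluate both degrees at the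
archimedean generator `(0, δ_v)`.  For `c₀ = 1` (norm preservation, `arith_logNorm_transport`) this reads
`c_v = [L₁,v : ℝ] / [L₂,σv : ℝ] ∈ {1, 2, 1/2}`. [cite: MochizukiFrdI2008, Thm. 6.4 (iv) p.116] -/
theorem mult_mul_scaling_eq (eG : ArithDivisor L₁ →+ ArithDivisor L₂)
    (eE : EffArithDivisor L₁ →+ EffArithDivisor L₂)
    (heG : ∀ D, eG (EffArithDivisor.toArithDivisor L₁ D) = EffArithDivisor.toArithDivisor L₂ (eE D))
    {σ : InfinitePlace L₁ ≃ InfinitePlace L₂} {c : InfinitePlace L₁ → NNReal}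
    {π : FinitePlace L₁ ≃ FinitePlace L₂}
    (h1 : ∀ D : EffArithDivisor L₁, (eE D).1 = Finsupp.equivMapDomain π D.1)
    (h2 : ∀ (D : EffArithDivisor L₁) (v : InfinitePlace L₁), (eE D).2 (σ v) = c v * D.2 v)
    {c₀ : ℝ} (hdeg : ∀ d, arithDegree L₂ (eG d) = c₀ * arithDegree L₁ d) (v : InfinitePlace L₁) :
    ((σ v).mult : ℝ) * c v = c₀ * v.mult := by
  classical
  have h := hdeg (EffArithDivisor.toArithDivisor L₁ (0, Pi.single v 1))
  rw [heG] at h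
  -- the image of the archimedean generator
  have himg : eE (0, Pi.single v 1) = (0, Pi.single (σ v) (c v)) := by
    refine Prod.ext ?_ (funext fun v' => ?_)
    · rw [h1]; exact Finsupp.equivMapDomain_zero
    · obtain ⟨u, rfl⟩ := σ.surjective v'
      rw [h2]
      show c u * (Pi.single v (1 : NNReal) : InfinitePlace L₁ → NNReal) u =
        (Pi.single (σ v) (c v) : InfinitePlace L₂ → NNReal) (σ u)
      by_cases hu : u = v
      · subst hu; rw [Pi.single_eq_same, Pi.single_eq_same, mul_one]
      · rw [Pi.single_eq_of_ne hu, Pi.single_eq_of_ne (fun h => hu (σ.injective h)), mul_zero]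
  have hto : ∀ (L : Type) [Field L] [NumberField L] (t : InfinitePlace L → NNReal),
      EffArithDivisor.toArithDivisor L (0, t) = (0, fun w => (t w : ℝ)) := fun L _ _ t => by
    refine Prod.ext (Finsupp.ext fun w => ?_) (funext fun w => ?_)
    · rw [EffArithDivisor.toArithDivisor_fst]; simp
    · rw [EffArithDivisor.toArithDivisor_snd]
  rw [himg, hto, hto, arithDegree_inf, arithDegree_inf, Finset.sum_eq_single (σ v),
    Finset.sum_eq_single v] at h
  · simpa [Pi.single_eq_same] using h
  · intro w _ hw; rw [Pi.single_eq_of_ne hw]; simp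
  · exact fun hv => absurd (Finset.mem_univ v) hv
  · intro w _ hw; rw [Pi.single_eq_of_ne hw]; simp
  · exact fun hv => absurd (Finset.mem_univ (σ v)) hv

end ArithDivisor

/-! ### Multiplicative form (the divisor monoid `Φ(Spec L) = Multiplicative (EffArithDivisor L)` of `C_{K/F}`) -/

namespace EffArithDivisor

variable {L₁ : Type} [Field L₁] [NumberField L₁] {L₂ : Type} [Field L₂] [NumberField L₂]

/-- Structure theorem, multiplicative form, archimedean part included: for a monoid isomorphism
`e : Φ(L₁) ⥲ Φ(L₂)` (e.g. the component `Ψ^Φ_X` of the Cor. 4.11 (iv) datum of an equivalence of arithmetic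
Frobenioids at `X = Spec L₁`), `e (ofAdd (f, t)) = ofAdd (π_* f, σ_* (c · t))` with `π` the
generator-to-generator bijection of finite places, `σ` a bijection of infinite places and `c_v > 0`.
[cite: MochizukiFrdI2008, Thm. 6.4 (iv) p.116] -/
theorem exists_decomposition_monomial_mulEquiv
    (e : Multiplicative (EffArithDivisor L₁) ≃* Multiplicative (EffArithDivisor L₂)) :
    ∃ (π : FinitePlace L₁ ≃ FinitePlace L₂) (σ : InfinitePlace L₁ ≃ InfinitePlace L₂)
      (c : InfinitePlace L₁ → NNReal), (∀ v, c v ≠ 0) ∧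
        (∀ w, e (Multiplicative.ofAdd (EffArithDivisor.single L₁ (Sum.inr w))) =
            Multiplicative.ofAdd (EffArithDivisor.single L₂ (Sum.inr (π w)))) ∧
          (∀ D : EffArithDivisor L₁, (Multiplicative.toAdd (e (Multiplicative.ofAdd D))).1 =
              Finsupp.equivMapDomain π D.1) ∧
            ∀ (D : EffArithDivisor L₁) (v : InfinitePlace L₁),
              (Multiplicative.toAdd (e (Multiplicative.ofAdd D))).2 (σ v) = c v * D.2 v := by
  obtain ⟨π, σ, c, hc, hπ, h1, h2⟩ := exists_decomposition_monomial (AddEquiv.toMultiplicative.symm e)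
  refine ⟨π, σ, c, hc, fun w => ?_, fun D => h1 D, fun D v => h2 D v⟩
  rw [single_inr, single_inr]
  exact congrArg Multiplicative.ofAdd (hπ w)

end EffArithDivisor

end Literature.AlgebraicGeometry.Frobenioids

end
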